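import Summits.RiemannHypothesis.RiemannHypothesis.Theorems.WeilFormatCZetaTailGram
import HarnessLib

/-!
# Format C, design C∞ (E3, analytic side): the energy of the uniform-order remainder weights

Route context: Fourier–Galerkin / Schur-complement certificates of Weil positivity on a window ("format C", C∞ door;
cell memo `run/shared/lean/pub/rh-explicit/rh-explicit-weil-10/KERNEL-LEVER.md` §21; supporting stmt-RiemannHypothesis-0098;
seat rh-explicit-weil-10).  The monomial forms of gen10 carry the remainder weight `w(m) = (m₀/m)^{E+1}`
(`m ≥ m₀ = B₃`); the `hW` hypothesis of `cinf_hUq_even/odd` (`coupling_majorant_gram_shifted_fintype`) wants an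
`N`-uniform bound of `Σ_{m∈[m₀,N)} w(m)²`:

* `weight_sq_eq` — `((m₀/m)^{E+1})² = m₀^{2E+2}·(1/m^{2E+2})`;
* ★ `sum_Ico_weight_sq_le` — `Σ_{m∈[m₀,N)} ((m₀/m)^{E+1})² ≤ m₀^{2E+2}/((2E+1)(m₀−1)^{2E+1})` (`m₀ ≥ 2`; zeta tail
  `tsum_one_div_add_pow_le` of `WeilFormatCZetaTailGram`) — so `W = m₀^{2E+2}/((2E+1)(m₀−1)^{2E+1}) ≈ m₀/(2E+1)`.

Elementary; standard axioms; no definitions; no RH claim.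
-/

set_option autoImplicit false
-- `Summit.RiemannHypothesis.RiemannHypothesis.…` is the layout-mandated namespace (summit = problem name).
set_option linter.dupNamespace false

open Finset
open scoped BigOperators

namespace Summit.RiemannHypothesis.RiemannHypothesis.Theorems.WeilFormatC

/-- `((m₀/m)^{E+1})² = m₀^{2E+2}·(1/m^{2E+2})`. -/
theorem weight_sq_eq (m₀ m : ℝ) (E : ℕ) :
    (((m₀ / m) ^ (E + 1)) ^ 2) = m₀ ^ (2 * E + 2) * (1 / m ^ (2 * E + 2)) := by
  rw [← pow_mul, show (E + 1) * 2 = 2 * E + 2 by ring, div_pow]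
  ring

/-- **The weight energy**: for `2 ≤ m₀` and every `N`,
`Σ_{m∈[m₀,N)} ((m₀/m)^{E+1})² ≤ m₀^{2E+2}/((2E+1)·(m₀−1)^{2E+1})`. -/
theorem sum_Ico_weight_sq_le {m₀ : ℕ} (hm₀ : 2 ≤ m₀) (E N : ℕ) :
    ∑ m ∈ Finset.Ico m₀ N, (((m₀ : ℝ) / m) ^ (E + 1)) ^ 2
      ≤ (m₀ : ℝ) ^ (2 * E + 2) / ((2 * E + 1 : ℝ) * (((m₀ - 1 : ℕ) : ℝ)) ^ (2 * E + 1)) := by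
  have he : 2 ≤ 2 * E + 2 := by omega
  simp_rw [weight_sq_eq]
  rw [← Finset.mul_sum, div_eq_mul_one_div]
  refine mul_le_mul_of_nonneg_left ?_ (by positivity)
  -- the finite tail is below the zeta tail
  have hsum : ∑ m ∈ Finset.Ico m₀ N, 1 / (m : ℝ) ^ (2 * E + 2)
      ≤ ∑' k : ℕ, 1 / ((m₀ : ℝ) + k) ^ (2 * E + 2) := by
    rw [Finset.sum_Ico_eq_sum_range]
    have e : ∀ k : ℕ, 1 / (((m₀ + k : ℕ) : ℝ)) ^ (2 * E + 2) = 1 / ((m₀ : ℝ) + k) ^ (2 * E + 2) := fun k ↦ by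
      push_cast; rfl
    simp_rw [e]
    exact Summable.sum_le_tsum (Finset.range (N - m₀)) (fun k _ ↦ by positivity) (summable_one_div_add_pow he m₀)
  refine hsum.trans ?_
  have h := tsum_one_div_add_pow_le he hm₀
  have e1 : ((2 * E + 2 : ℕ) : ℝ) - 1 = 2 * E + 1 := by push_cast; ring
  rw [e1, show 2 * E + 2 - 1 = 2 * E + 1 by omega] at h
  exact h

end Summit.RiemannHypothesis.RiemannHypothesis.Theorems.WeilFormatC
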